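import Mathlib
import Summits.ResolutionOfSingularities.ResolutionOfSingularities.Theorems.WeightedInvariantLocalWeightedDropTOT2CurveConflictConverse
import Summits.ResolutionOfSingularities.ResolutionOfSingularities.Theorems.WeightedInvariantLocalWeightedDropTOT2CurveSwapPointMove

/-!
# `LocalWeightedDrop`, NC count game — TOT2-LINE piece S-CRV (v1.3 (P3)): the CONVERSE of F1^ — `u₂`-graph data at the `u₂`-chart origin come from
# tangent `u₂`-graph data downstairs

[OURS · L1 W4.3 · chain w43, engine crux `LocalWeightedDrop` stmt-ResolutionOfSingularities-8899; piece (P3) = res-type-088; `--supports 8899 --as helper`,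
counted 0; definition-free; nothing here is a statement of any manuscript; AI-written (gate-accepted = sorry-free with standard axioms, not refereed).]

Conjugating `graph_of_blowOneT_origin` (…TOT2CurveConflictConverse) by the swap (`swap_blowTwoT`, …TOT2CurveSwapPointMove):
* **`graph_of_swap_blowTwoT_origin`** — if the swapped `u₂`-chart label `(blowTwoT d A)^` of a position `A` carries a permissible graph branch with
  `u₂`-free datum `g₁`, then `Â` carries one with the tangent datum `u₁·g₁`: the `u₂`-graphs upstairs at the `u₂`-chart origin are exactly the
  tangent `u₂`-graphs downstairs with contact lowered by one (with F1^) — the accounting of the `T₁` term at that successor is two-sided;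
* `hasGraphCurveT_swap_of_blowTwoT_origin` — predicate form.
-/

set_option linter.dupNamespace false -- mandated namespace of this single-conjunct summit

noncomputable section

namespace Summit.ResolutionOfSingularities.ResolutionOfSingularities.Theorems

namespace TOT2Curve

open MvPowerSeries PolyDescent MonicDescent WildMonic Literature.AlgebraicGeometry.Resolution

variable {k : Type} [Field k] {d : ℕ}

/-- **CONVERSE OF F1^.**  A graph datum `g₁` of the swapped `u₂`-chart label comes from the tangent datum `u₁·g₁` of the swapped label. -/
theorem graph_of_swap_blowTwoT_origin (A : Fin d → MvPowerSeries (Fin 2) k) (hA : IsPosT d A) (g₁ ψ' : MvPowerSeries (Fin 2) k)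
    (hg₁ : ∀ e : Fin 2 →₀ ℕ, e 1 ≠ 0 → coeff e g₁ = 0)
    (hperm' : IsPermissibleTwoT d (shift d (shearT g₁ (fun j => subst (![X 1, X 0] : Fin 2 → MvPowerSeries (Fin 2) k) (blowTwoT d A j))) ψ')) :
    ∃ ψ : MvPowerSeries (Fin 2) k, constantCoeff ψ = 0 ∧
      IsPermissibleTwoT d (shift d (shearT (X 0 * g₁) (fun i => subst (![X 1, X 0] : Fin 2 → MvPowerSeries (Fin 2) k) (A i))) ψ) := by
  rw [swap_blowTwoT] at hperm'
  exact graph_of_blowOneT_origin _ ((isPosT_swap_iff A).mpr hA) g₁ ψ' hg₁ hperm'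

/-- Predicate form. -/
theorem hasGraphCurveT_swap_of_blowTwoT_origin (A : Fin d → MvPowerSeries (Fin 2) k) (hA : IsPosT d A)
    (h : HasGraphCurveT d (fun j => subst (![X 1, X 0] : Fin 2 → MvPowerSeries (Fin 2) k) (blowTwoT d A j))) :
    ∃ g₁ ψ : MvPowerSeries (Fin 2) k, (∀ e : Fin 2 →₀ ℕ, e 1 ≠ 0 → coeff e g₁ = 0) ∧ constantCoeff ψ = 0 ∧
      IsPermissibleTwoT d (shift d (shearT (X 0 * g₁) (fun i => subst (![X 1, X 0] : Fin 2 → MvPowerSeries (Fin 2) k) (A i))) ψ) := by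
  obtain ⟨g₁, ψ', hg₁, -, hperm'⟩ := h
  obtain ⟨ψ, hψ, hperm⟩ := graph_of_swap_blowTwoT_origin A hA g₁ ψ' hg₁ hperm'
  exact ⟨g₁, ψ, hg₁, hψ, hperm⟩

end TOT2Curve

end Summit.ResolutionOfSingularities.ResolutionOfSingularities.Theorems

end
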